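import Literature.Probability.Percolation.TriDiscShelling
import HarnessLib

/-!
# The tiling of the triangular lattice by hexagonal balls of radius 2

Topic `Literature/Probability/Percolation`; family `crit-perc`. A coarse-graining device for
building *regular* discrete domains: the triangular lattice `𝕋` is tiled by the hexagonal
balls of radius `2` (`19` sites) centred on the sublattice `α𝕋`, `α = 3 + 2ω` (index `19`), and
a union of tiles has, at every site, a ring pattern which is a single cyclic block — so that
neither it nor its outer boundary can have a cut vertex, the standing restriction of
Bollobás–Riordan on discrete domains (*Percolation* (2006), Ch. 7 §7.2.2 p. 168: "we shall assume
that neither `G` nor `∂⁺(G)` has a cut-vertex"), which their construction of the approximating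
domains `G_δ^±` (Lemma 14, p. 190) does not by itself provide.

* `coarseMul` (`c ↦ αc`), `tilePhi` (residue `12x₀ + x₁ mod 19`), `tileRep` (representatives in
  the ball of radius `2`), `tileCentre` (coarse centre of the tile of a site), `tileOff` (coarse
  offsets of the tiles of the neighbours), `tileUnion S'` (union of the tiles with centres in
  `S'`), `IsCyclicBlock` (a Boolean pattern on the six directions is one cyclic block).
* `coarseMul_tileCentre_add` (every site is `α · centre + representative`),
  `tileRep_tilePhi_of_triNorm_le` (the ball of radius `2` is a fundamental domain),
  `tileCentre_coarseMul_add` (equivariance), `mem_tileUnion_iff`.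
* `tileCentre_eq_or_adj_of_adj` — **adjacent sites lie in equal or adjacent tiles**;
  `isCyclicBlock_tileUnion` — **the ring pattern of a union of tiles is one cyclic block at
  every site** (`isCyclicBlock_of_tilePattern`, a finite check over the `19` residues by
  `decide`).

## References

* B. Bollobás, O. Riordan, *Percolation*, Cambridge University Press (2006), Ch. 7 §7.2.2
  p. 168, §7.2.5 p. 190.

## Mathlib / tree

Mathlib: `ZMod`, `decide`. Tree: `TriDiscShelling.lean` (`triDir`), `TriangularLattice`
(`triNorm`, `triBall`, `abs_le_triNorm`).
-/

noncomputable section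

open Literature.Probability.LatticeModels

namespace Literature.Probability.Percolation

/-- **Coarse-to-fine map**: multiplication by `α = 3 + 2ω` in the Eisenstein integers,
`c ↦ (3c₀ - 2c₁, 2c₀ + 5c₁)`; its image is the sublattice of tile centres (index `19`). [folklore] -/
def coarseMul (c : Site 2) : Site 2 := fun i => ![3 * c 0 - 2 * c 1, 2 * c 0 + 5 * c 1] i

/-- The residue of a site modulo the sublattice of tile centres: `12x₀ + x₁ (mod 19)`. [folklore] -/
def tilePhi (x : Site 2) : ZMod 19 := ((12 * x 0 + x 1 : ℤ) : ZMod 19)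

/-- The representative of each residue in the hexagonal ball of radius `2`. [folklore] -/
def tileRep (k : ZMod 19) : Site 2 := fun i =>
  (![![0, 0], ![0, 1], ![0, 2], ![2, -2], ![2, -1], ![2, 0], ![-1, -1], ![-1, 0], ![-1, 1], ![-1, 2], ![1, -2],
    ![1, -1], ![1, 0], ![1, 1], ![-2, 0], ![-2, 1], ![-2, 2], ![0, -2], ![0, -1]] : Fin 19 → Fin 2 → ℤ) k i

/-- **The coarse centre of the tile containing a site**: `x = coarseMul (tileCentre x) + b` with
`b = tileRep (tilePhi x)` in the ball of radius `2`. [folklore] -/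
def tileCentre (x : Site 2) : Site 2 := fun i =>
  ![(5 * (x 0 - tileRep (tilePhi x) 0) + 2 * (x 1 - tileRep (tilePhi x) 1)) / 19,
    (3 * (x 1 - tileRep (tilePhi x) 1) - 2 * (x 0 - tileRep (tilePhi x) 0)) / 19] i

/-- First coordinate of `coarseMul`. [folklore] -/
@[simp] theorem coarseMul_zero_apply (c : Site 2) : coarseMul c 0 = 3 * c 0 - 2 * c 1 := rfl

/-- Second coordinate of `coarseMul`. [folklore] -/
@[simp] theorem coarseMul_one_apply (c : Site 2) : coarseMul c 1 = 2 * c 0 + 5 * c 1 := rfl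

/-- `coarseMul` is additive. [folklore] -/
theorem coarseMul_add (c c' : Site 2) : coarseMul (c + c') = coarseMul c + coarseMul c' := by
  ext i; fin_cases i <;> simp [coarseMul] <;> ring

/-- `tilePhi` is additive. [folklore] -/
theorem tilePhi_add (x y : Site 2) : tilePhi (x + y) = tilePhi x + tilePhi y := by
  simp only [tilePhi, Pi.add_apply]; push_cast; ring

/-- `tilePhi` of a difference. [folklore] -/
theorem tilePhi_sub (x y : Site 2) : tilePhi (x - y) = tilePhi x - tilePhi y := by
  simp only [tilePhi, Pi.sub_apply]; push_cast; ring

/-- **The tile centres have residue `0`.** [folklore] -/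
theorem tilePhi_coarseMul (c : Site 2) : tilePhi (coarseMul c) = 0 := by
  simp only [tilePhi, coarseMul_zero_apply, coarseMul_one_apply]
  have e : (12 * (3 * c 0 - 2 * c 1) + (2 * c 0 + 5 * c 1) : ℤ) = 19 * (2 * c 0 - c 1) := by ring
  rw [e]; push_cast
  have h19 : ((19 : ℤ) : ZMod 19) = 0 := by decide
  rw [show (19 : ZMod 19) = ((19 : ℤ) : ZMod 19) by push_cast; rfl, h19, zero_mul]

/-- **Residue `0` means divisibility** of the two combinations defining `tileCentre`. [folklore] -/
theorem dvd_of_tilePhi_eq_zero {d : Site 2} (h : tilePhi d = 0) : (19 : ℤ) ∣ 5 * d 0 + 2 * d 1 ∧ (19 : ℤ) ∣ 3 * d 1 - 2 * d 0 := by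
  have h' : (19 : ℤ) ∣ 12 * d 0 + d 1 := by
    rw [tilePhi] at h
    exact (ZMod.intCast_zmod_eq_zero_iff_dvd _ 19).1 h
  obtain ⟨t, ht⟩ := h'
  refine ⟨⟨2 * t - d 0, by linarith⟩, ⟨3 * t - 2 * d 0, by linarith⟩⟩

/-- The residues of the representatives. [folklore] -/
theorem tilePhi_tileRep (k : ZMod 19) : tilePhi (tileRep k) = k := by
  revert k; decide

/-- The representatives lie in the ball of radius `2`. [folklore] -/
theorem triNorm_tileRep_le (k : ZMod 19) : triNorm (tileRep k) ≤ 2 := by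
  revert k; decide

/-- **Reconstruction**: every site is its tile centre (scaled) plus its representative. [folklore] -/
theorem coarseMul_tileCentre_add (x : Site 2) : coarseMul (tileCentre x) + tileRep (tilePhi x) = x := by
  have h0 : tilePhi (x - tileRep (tilePhi x)) = 0 := by rw [tilePhi_sub, tilePhi_tileRep, sub_self]
  obtain ⟨⟨a, ha⟩, ⟨b, hb⟩⟩ := dvd_of_tilePhi_eq_zero h0
  simp only [Pi.sub_apply] at ha hb
  have hc0 : tileCentre x 0 = a := by
    show (5 * (x 0 - tileRep (tilePhi x) 0) + 2 * (x 1 - tileRep (tilePhi x) 1)) / 19 = a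
    rw [ha, Int.mul_ediv_cancel_left _ (by norm_num)]
  have hc1 : tileCentre x 1 = b := by
    show (3 * (x 1 - tileRep (tilePhi x) 1) - 2 * (x 0 - tileRep (tilePhi x) 0)) / 19 = b
    rw [hb, Int.mul_ediv_cancel_left _ (by norm_num)]
  ext i; fin_cases i
  · show coarseMul (tileCentre x) 0 + tileRep (tilePhi x) 0 = x 0
    rw [coarseMul_zero_apply, hc0, hc1]; linarith
  · show coarseMul (tileCentre x) 1 + tileRep (tilePhi x) 1 = x 1
    rw [coarseMul_one_apply, hc0, hc1]; linarith

/-- A site is within hexagonal distance `2` of its (scaled) tile centre. [folklore] -/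
theorem triNorm_sub_coarseMul_tileCentre (x : Site 2) : triNorm (x - coarseMul (tileCentre x)) ≤ 2 := by
  have e : x - coarseMul (tileCentre x) = tileRep (tilePhi x) :=
    sub_eq_iff_eq_add'.2 (coarseMul_tileCentre_add x).symm
  rw [e]; exact triNorm_tileRep_le _

/-- **Equivariance**: shifting by a tile centre shifts the coarse centre. [folklore] -/
theorem tileCentre_coarseMul_add (c y : Site 2) : tileCentre (coarseMul c + y) = c + tileCentre y := by
  have hφ : tilePhi (coarseMul c + y) = tilePhi y := by rw [tilePhi_add, tilePhi_coarseMul, zero_add]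
  ext i; fin_cases i
  · show (5 * ((coarseMul c + y) 0 - tileRep (tilePhi (coarseMul c + y)) 0) +
        2 * ((coarseMul c + y) 1 - tileRep (tilePhi (coarseMul c + y)) 1)) / 19 = c 0 + _
    rw [hφ]
    show _ = c 0 + (5 * (y 0 - tileRep (tilePhi y) 0) + 2 * (y 1 - tileRep (tilePhi y) 1)) / 19
    simp only [Pi.add_apply, coarseMul_zero_apply, coarseMul_one_apply]
    rw [show 5 * (3 * c 0 - 2 * c 1 + y 0 - tileRep (tilePhi y) 0) + 2 * (2 * c 0 + 5 * c 1 + y 1 - tileRep (tilePhi y) 1) =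
      (5 * (y 0 - tileRep (tilePhi y) 0) + 2 * (y 1 - tileRep (tilePhi y) 1)) + c 0 * 19 by ring,
      Int.add_mul_ediv_right _ _ (by norm_num)]
    ring
  · show (3 * ((coarseMul c + y) 1 - tileRep (tilePhi (coarseMul c + y)) 1) -
        2 * ((coarseMul c + y) 0 - tileRep (tilePhi (coarseMul c + y)) 0)) / 19 = c 1 + _
    rw [hφ]
    show _ = c 1 + (3 * (y 1 - tileRep (tilePhi y) 1) - 2 * (y 0 - tileRep (tilePhi y) 0)) / 19
    simp only [Pi.add_apply, coarseMul_zero_apply, coarseMul_one_apply]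
    rw [show 3 * (2 * c 0 + 5 * c 1 + y 1 - tileRep (tilePhi y) 1) - 2 * (3 * c 0 - 2 * c 1 + y 0 - tileRep (tilePhi y) 0) =
      (3 * (y 1 - tileRep (tilePhi y) 1) - 2 * (y 0 - tileRep (tilePhi y) 0)) + c 1 * 19 by ring,
      Int.add_mul_ediv_right _ _ (by norm_num)]
    ring

/-- The representatives are the sites of their own tile: their coarse centre is `0`. [folklore] -/
theorem tileCentre_tileRep (k : ZMod 19) : tileCentre (tileRep k) = 0 := by
  revert k; decide

/-- **The centre of a tile site**: `tileCentre (coarseMul c + tileRep k) = c`. [folklore] -/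
theorem tileCentre_coarseMul_add_tileRep (c : Site 2) (k : ZMod 19) : tileCentre (coarseMul c + tileRep k) = c := by
  rw [tileCentre_coarseMul_add, tileCentre_tileRep, add_zero]

/-! ### The coarse offsets of the neighbours of a site -/

/-- The coarse offset of the tile of the neighbour `x + e_j`, as a function of the residue of `x`. [folklore] -/
def tileOff (k : ZMod 19) (j : Fin 6) : Site 2 := tileCentre (tileRep k + triDir j)

/-- **The tile of a neighbour** is the tile of the site shifted by the tabulated coarse offset. [folklore] -/
theorem tileCentre_add_triDir (x : Site 2) (j : Fin 6) :
    tileCentre (x + triDir j) = tileCentre x + tileOff (tilePhi x) j := by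
  have h := coarseMul_tileCentre_add x
  calc tileCentre (x + triDir j) = tileCentre (coarseMul (tileCentre x) + (tileRep (tilePhi x) + triDir j)) := by
        rw [← add_assoc, h]
    _ = tileCentre x + tileOff (tilePhi x) j := by rw [tileCentre_coarseMul_add, tileOff]

/-- **Neighbouring sites lie in equal or adjacent tiles**: the coarse offsets are `0` or unit
directions. [folklore] -/
theorem tileOff_eq_zero_or (k : ZMod 19) (j : Fin 6) : tileOff k j = 0 ∨ ∃ i : Fin 6, tileOff k j = triDir i := by
  revert k j; decide

/-! ### The ring patterns of unions of tiles are single blocks -/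

/-- A Boolean pattern on the six directions is **one cyclic block**: all, none, or exactly the
`m` consecutive directions `a, …, a + m - 1`. [folklore] -/
def IsCyclicBlock (g : Fin 6 → Bool) : Prop :=
  (∀ j, g j = true) ∨ (∀ j, g j = false) ∨ ∃ a m : Fin 6, 1 ≤ m.val ∧ ∀ t : Fin 6, g (a + t) = true ↔ t.val < m.val

/-- Being one cyclic block is decidable. [folklore] -/
instance : DecidablePred IsCyclicBlock := fun g => by unfold IsCyclicBlock; infer_instance

set_option maxRecDepth 20000 in
/-- **The ring pattern of a union of tiles at any site is one cyclic block.** For a site of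
residue `k`, membership of its six neighbours in a union of tiles is a Boolean pattern `g`
which is constant on neighbours lying in the same tile and takes the value `own` (membership of
the site's own tile) on neighbours in the site's tile; every such pattern is one cyclic block
(a finite check over the `19` residues). [folklore] -/
theorem isCyclicBlock_of_tilePattern (k : ZMod 19) (own : Bool) (g : Fin 6 → Bool)
    (hcompat : ∀ i j : Fin 6, tileOff k i = tileOff k j → g i = g j) (hown : ∀ j, tileOff k j = 0 → g j = own) :
    IsCyclicBlock g := by
  revert hown hcompat g own
  fin_cases k
  all_goals decide

/-! ### Unions of tiles -/

open Finset

/-- **Every site of the ball of radius `2` is the representative of its residue** (the ball is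
a fundamental domain of the sublattice of tile centres). [folklore] -/
theorem tileRep_tilePhi_of_triNorm_le {b : Site 2} (hb : triNorm b ≤ 2) : tileRep (tilePhi b) = b := by
  obtain ⟨h0, h1, h2⟩ := abs_le_triNorm b
  have hb0 : b 0 ≤ 2 ∧ -2 ≤ b 0 := by rw [abs_le] at h0; omega
  have hb1 : b 1 ≤ 2 ∧ -2 ≤ b 1 := by rw [abs_le] at h1; omega
  have hb2 : b 0 + b 1 ≤ 2 ∧ -2 ≤ b 0 + b 1 := by rw [abs_le] at h2; omega
  have key : ∀ u v : ℤ, u ≤ 2 → -2 ≤ u → v ≤ 2 → -2 ≤ v → u + v ≤ 2 → -2 ≤ u + v →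
      tileRep (tilePhi (fun i => ![u, v] i)) = fun i => ![u, v] i := by
    intro u v hu hu' hv hv' huv huv'
    interval_cases u <;> interval_cases v <;> first | omega | decide
  have e : b = fun i => ![b 0, b 1] i := by ext i; fin_cases i <;> rfl
  rw [e]
  exact key (b 0) (b 1) hb0.1 hb0.2 hb1.1 hb1.2 hb2.1 hb2.2

/-- **The union of the tiles** with coarse centres in `S'`. [folklore] -/
def tileUnion (S' : Finset (Site 2)) : Finset (Site 2) :=
  S'.biUnion fun c => (triBall 2).image fun b => coarseMul c + b

/-- **Membership in a union of tiles** is membership of the coarse centre. [folklore] -/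
theorem mem_tileUnion_iff {S' : Finset (Site 2)} {x : Site 2} : x ∈ tileUnion S' ↔ tileCentre x ∈ S' := by
  rw [tileUnion, mem_biUnion]
  constructor
  · rintro ⟨c, hc, hx⟩
    obtain ⟨b, hb, rfl⟩ := mem_image.1 hx
    rw [mem_triBall_iff] at hb
    have e : b = tileRep (tilePhi b) := (tileRep_tilePhi_of_triNorm_le (by exact_mod_cast hb)).symm
    have : tileCentre (coarseMul c + b) = c := by
      rw [e, tileCentre_coarseMul_add_tileRep]
    rwa [this]
  · intro h
    refine ⟨tileCentre x, h, mem_image.2 ⟨tileRep (tilePhi x), ?_, coarseMul_tileCentre_add x⟩⟩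
    rw [mem_triBall_iff]; exact_mod_cast triNorm_tileRep_le _

/-- **Adjacent sites lie in equal or adjacent tiles.** [folklore] -/
theorem tileCentre_eq_or_adj_of_adj {x y : Site 2} (h : triGraph.Adj x y) :
    tileCentre x = tileCentre y ∨ triGraph.Adj (tileCentre x) (tileCentre y) := by
  obtain ⟨j, rfl⟩ := (triGraph_adj_iff_triDir x y).1 h
  rw [tileCentre_add_triDir]
  rcases tileOff_eq_zero_or (tilePhi x) j with h0 | ⟨i, hi⟩
  · left; rw [h0, add_zero]
  · right; rw [hi]; exact triGraph_adj_add_triDir _ i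

/-- **The ring pattern of a union of tiles is one cyclic block at every site**: the set of
directions `j` with `x + e_j` in the union is all, none, or one block of consecutive
directions. [folklore] -/
theorem isCyclicBlock_tileUnion (S' : Finset (Site 2)) (x : Site 2) :
    IsCyclicBlock fun j => decide (x + triDir j ∈ tileUnion S') := by
  have e : (fun j => decide (x + triDir j ∈ tileUnion S')) =
      fun j => decide (tileCentre x + tileOff (tilePhi x) j ∈ S') := by
    funext j
    rw [Bool.decide_congr (mem_tileUnion_iff.trans (by rw [tileCentre_add_triDir]))]
  rw [e]
  refine isCyclicBlock_of_tilePattern (tilePhi x) (decide (tileCentre x ∈ S')) _ (fun i j hij => by simp only [hij])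
    (fun j hj => by simp only [hj, add_zero])

end Literature.Probability.Percolation
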